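import Mathlib
import Summits.ValiantsHypothesis.ValiantsHypothesis.Theorems.FeketeSOSCharPSparseSOSTwoCuspSquareVsSparse
import Summits.ValiantsHypothesis.ValiantsHypothesis.Theorems.FeketeSOSCharPSparseSOSTwoCuspTrivial
import Summits.ValiantsHypothesis.ValiantsHypothesis.Theorems.FeketeSOSCharPSparseSOSTwoCuspUncertainty

/-!
# Crux `FeketeSOS.CharPSparseSOS` (stmt-ValiantsHypothesis-14989), line `Sketch` — the two-cusp
inequality for ONE fat square (`twoCuspInequality_oneFatSquare`)

Over a field `K` of characteristic `p`, let `P = (Σ_{i ≤ s} c_i g_i²) mod (X^p − 1)` with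
`deg g_i < p`, one "fat" square `g₀` with `t = #supp g₀` monomials and `s` further squares of total
folded sparsity `k = Σ_{1 ≤ i ≤ s} (#supp g_i)²`.  If `P ≠ 0`, `(X − 1)^D ∣ P` (depth `≥ D` at the
upper cusp) and `P` is deep `≥ D` at the lower cusp (`P_0 = 0` for `D ≥ 1` and
`Σ_{n<p} P_n n^{p−1−d} = 0` for `1 ≤ d < D`), then `D ≤ (k + 2) t + k` — a bound LINEAR in `t`.

Proof (bookkeeping over three landed theorems).  Split off the fat square:
`Σ_i c_i g_i² = c₀ g₀² + R`, and put `B = −(R mod (X^p − 1))`, so `#supp B ≤ k`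
(`card_support_sos_fold_le`), `deg B < p` and `P = (c₀ g₀² − B) mod (X^p − 1)`.  By
`squareVsSparse_oneCusp`, either `D ≤ (#supp B + 2) t + #supp B ≤ (k + 2) t + k`, or
`p + 2 ≤ ord₁ P + #supp B`; in the latter case the two-cusp uncertainty principle
`twoCuspUncertainty` (with `D₁ = ord₁ P`, `D₂ = D`) gives `ord₁ P + D ≤ p − 1`, whence
`D + 3 ≤ #supp B ≤ k`.
-/

-- `Summit.ValiantsHypothesis.ValiantsHypothesis.…` is the tree's mandated single-conjunct layout (Sub = Summit).
set_option linter.dupNamespace false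

namespace Summit.ValiantsHypothesis.ValiantsHypothesis.Theorems.CharPSparseSOSTwoCusp

open Polynomial Finset

/-- **The two-cusp inequality for one fat square.**  Over a field `K` of characteristic `p`, let
`P = (Σ_{i ≤ s} c_i g_i²) mod (X^p − 1)` with `deg g_i < p`, `t = #supp g₀` and
`k = Σ_{1 ≤ i ≤ s} (#supp g_i)²`.  If `P ≠ 0`, `(X − 1)^D ∣ P`, and `P` is deep `≥ D` at the lower cusp
(`P_0 = 0` for `D ≥ 1`, `Σ_{n<p} P_n n^{p−1−d} = 0` for `1 ≤ d < D`), then `D ≤ (k + 2) t + k`. -/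
theorem twoCuspInequality_oneFatSquare :
    ∀ (K : Type) [Field K] (p : ℕ) [Fact p.Prime] [CharP K p] (s : ℕ) (c : Fin (s + 1) → K)
      (g : Fin (s + 1) → K[X]) (P : K[X]) (D : ℕ),
      (∀ i, (g i).natDegree < p) →
      P = (∑ i, C (c i) * g i ^ 2) %ₘ (X ^ p - 1) →
      P ≠ 0 →
      (X - C (1 : K)) ^ D ∣ P →
      (1 ≤ D → P.coeff 0 = 0) →
      (∀ d : ℕ, 1 ≤ d → d < D → ∑ n ∈ Finset.range p, P.coeff n * (n : K) ^ (p - 1 - d) = 0) →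
      D ≤ ((∑ i : Fin s, (g i.succ).support.card ^ 2) + 2) * (g 0).support.card
        + ∑ i : Fin s, (g i.succ).support.card ^ 2 := by
  intro K _ p _ _ s c g P D hdeg hP hP0 hD h0 hmom
  have hprime : p.Prime := Fact.out
  have hp : 0 < p := hprime.pos
  have hmonic : ((X : K[X]) ^ p - 1).Monic :=
    monic_X_pow_sub (by rw [degree_one]; exact_mod_cast hp)
  -- Folds modulo `X^p − 1` have degree `< p`.
  have hdeg_fold : ∀ f : K[X], (f %ₘ ((X : K[X]) ^ p - 1)).natDegree < p := fun f => by
    have hq1 : ((X : K[X]) ^ p - 1) ≠ 1 := by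
      intro h
      have h' := congrArg natDegree h
      rw [← C_1, natDegree_X_pow_sub_C, natDegree_C] at h'
      omega
    have h := natDegree_modByMonic_lt f hmonic hq1
    rwa [← C_1, natDegree_X_pow_sub_C] at h
  -- The folded small squares `B = −(R mod (X^p − 1))` and their total folded sparsity `k`.
  set B : K[X] := -((∑ i : Fin s, C (c i.succ) * g i.succ ^ 2) %ₘ (X ^ p - 1)) with hB
  set k : ℕ := ∑ i : Fin s, (g i.succ).support.card ^ 2 with hk
  have hBk : B.support.card ≤ k := by
    rw [hB, support_neg]
    exact card_support_sos_fold_le p hp s (fun i => c i.succ) (fun i => g i.succ)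
  have hdegB : B.natDegree < p := by
    rw [hB, natDegree_neg]
    exact hdeg_fold _
  have hBmod : B %ₘ (X ^ p - 1) = B := by
    rw [hB, neg_modByMonic, neg_inj]
    exact (modByMonic_eq_self_iff hmonic).2 (degree_modByMonic_lt _ hmonic)
  -- `P = (c₀ g₀² − B) mod (X^p − 1)`.
  have hP' : P = (C (c 0) * g 0 ^ 2 - B) %ₘ (X ^ p - 1) := by
    rw [hP, Fin.sum_univ_succ, add_modByMonic, sub_modByMonic, hBmod, hB, sub_neg_eq_add]
  rcases squareVsSparse_oneCusp K p (c 0) (g 0) B P D (hdeg 0) hdegB hP' hP0 hD with h | h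
  · -- `D ≤ (#supp B + 2) t + #supp B ≤ (k + 2) t + k`.
    calc D ≤ (B.support.card + 2) * (g 0).support.card + B.support.card := h
      _ ≤ (k + 2) * (g 0).support.card + k :=
        Nat.add_le_add (Nat.mul_le_mul_right _ (Nat.add_le_add_right hBk 2)) hBk
  · -- Socle window: `p + 2 ≤ ord₁ P + #supp B`, and uncertainty gives `ord₁ P + D ≤ p − 1`.
    have hdegP : P.natDegree < p := hP ▸ hdeg_fold _
    have hU := twoCuspUncertainty K p P (P.rootMultiplicity 1) D hP0 hdegP
      (pow_rootMultiplicity_dvd P 1) h0 hmom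
    have hDk : D ≤ k := by omega
    exact hDk.trans (Nat.le_add_left k _)

end Summit.ValiantsHypothesis.ValiantsHypothesis.Theorems.CharPSparseSOSTwoCusp
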